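import Summits.HodgeConjecture.HodgeConjecture.Theorems.Ring2WeilCoverageCMFieldSexticCells
import Summits.HodgeConjecture.HodgeConjecture.Theorems.Ring2WeilCoverageCMFieldCarrierCyclotomic
import Mathlib.NumberTheory.Cyclotomic.Gal
import Mathlib.RingTheory.ZMod.UnitsCyclic
import HarnessLib

/-!
# Ring 2 — Weil-type family-coverage census, CM-field rows (X-V): the SEXTIC carriers `ℚ(ζ₇) = ℚ[T]/(T⁶+7T⁴+14T²+7)`
# and `ℚ(ζ₉) = ℚ[T]/(T⁶+6T⁴+9T²+3)` in the kernel (cyclotomic, Galois, cyclic), and on EVERY row `W12.E.δ` of the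
# `g = 12` tables a CM twelvefold `B⁴`, `B` a SIMPLE CM threefold, with HC in the kernel

HONEST FRAMING: research route conditional on HC_CM; not a corollary; Q11.4-sentence-2 already refuted in dim ≥ 3.

Cell `pub-hodge-ring2`, seat `ring2-b03` (gen 58), census «## b03» (iv′): rows `(3,2)` (`E` sextic CM over cubic `F = E⁺`,
twelvefolds of Weil signature `(2,2;2,2;2,2)`, `W_E ⊂ H⁴` of codim 2, `δ ∈ cmNormResidueGroup R`); presentation `η = ζ − ζ⁻¹`:

| field `E` | `R` (`= minpoly(η²)`, roots `(ζᵏ − ζ⁻ᵏ)² = −4 sin²(2πk/n)`) | `ζ ∈ E` as a polynomial in `η` | check |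
|---|---|---|---|
| `ℚ(ζ₇)` | `S³ + 7S² + 14S + 7` | `ζ₇ = (−5 + η − 5η² − η⁴)/2` | `Φ₇(ζ₇) = 0` |
| `ℚ(ζ₉)` | `S³ + 6S² + 9S + 3` | `ζ₉ = (−4 + η − 5η² − η⁴)/2` | `Φ₉(ζ₉) = Φ₃(ζ₉³) = 0` |

(`R(S) = m(S + 2)`, `m` the minimal polynomial of `2cos(2π/n)`; `R(T²)` is Eisenstein at `7` resp. `3`.) Per field, all from
`η⁶ + aη⁴ + bη² + c = 0` by `linear_combination`: `…_fact_cmPolyQ`, `…_fact_realPolyQ` (Eisenstein; stated for `R` LITERALLY),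
`…_isPrimitiveRoot`, `…_mul_conj`, `…_cmRoot_eq` (`η = ζ − ζⁿ⁻¹`), **`…_roots_real_neg`** (root-of-unity route of part X-U),
**`…_isCyclotomicExtension`**, `…_isGalois`, **`…_isCyclic`** (`Gal ↪ (ℤ/n)^×`; literal `R`), and
**`…_carrier_rows_hodgeConjectureFor`**: for EVERY `δ ∈ cmNormResidueGroup R` a CM twelvefold `A ≅ B⁴`, `B` a SIMPLE CM
threefold, `IsWeilTypeCM A η R 3 2`, a Rosati-compatible polarization class of discriminant `δ`, `HodgeConjectureFor A.dim A.X`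
(kernel: Pohlmann / Schmidt Kap. III Satz 2.1) and `W_E(A) ⊗ ℂ ⊂ H⁴` algebraic; `…_carrier_allRanks_hodgeConjectureFor`.

THEOREMS ONLY: no `def`, no named fact, no `sorry`; `HC_CM` does not occur. HONEST COLUMN: named CM members only; the δ-class
tables of these fields are a certified computation recorded in the census; nothing at the general member of any row (stmt-1076).

## References
* [Deligne1982HodgeCycles] P. Deligne (notes by J. S. Milne), LNM 900 (1982), §4 p. 30, §5 (c) pp. 38–39.
* [Washington1997] L. C. Washington, *Introduction to Cyclotomic Fields*, GTM 83, Ch. 2 (`Gal(ℚ(ζₙ)/ℚ) ≅ (ℤ/n)^×`).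
* [Schmidt1984CMArithmetik] C.-G. Schmidt, LNM 1082 (1984), Kap. III Satz 2.1. [Pohlmann1968] H. Pohlmann, Ann. of Math. 88 (1968), Thm. 1.
-/

noncomputable section

set_option linter.dupNamespace false
namespace Summit.HodgeConjecture.HodgeConjecture.Ring2.WeilCoverageCM

open CategoryTheory CategoryTheory.Limits Polynomial NumberField
open Literature.AlgebraicGeometry Literature.AlgebraicGeometry.Motives Literature.AlgebraicGeometry.HodgeTheory
open Literature.AlgebraicGeometry.ComplexMultiplication Literature.AlgebraicGeometry.Deligne1982
open Literature.AlgebraicGeometry.Milne1999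
open Summit.HodgeConjecture.HodgeConjecture.Ring2.Hypotheses (RosatiCompatible)
/-! ## §1 `ℚ(ζ₇)`: `R = S³ + 7S² + 14S + 7`, `η = ζ₇ − ζ₇⁻¹` -/

section Zeta7

variable {R : Polynomial ℤ} (hR : R = X ^ 3 + C 7 * X ^ 2 + C 14 * X + C 7)
include hR

omit hR in
/-- `T⁶ + 7T⁴ + 14T² + 7` (the minimal polynomial of `ζ₇ − ζ₇⁻¹ = 2i sin(2π/7)`) is Eisenstein at `7`, hence
irreducible over `ℤ`. [folklore] -/
theorem zeta7_irreducible_cmPoly_int :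
    Irreducible (X ^ 6 + C (7 : ℤ) * X ^ 4 + C 14 * X ^ 2 + C 7 : Polynomial ℤ) := by
  have hmonic : (X ^ 6 + C (7 : ℤ) * X ^ 4 + C 14 * X ^ 2 + C 7 : Polynomial ℤ).Monic := by monicity!
  have hdeg : (X ^ 6 + C (7 : ℤ) * X ^ 4 + C 14 * X ^ 2 + C 7 : Polynomial ℤ).natDegree = 6 := by compute_degree!
  have hprime : (Ideal.span {(7 : ℤ)}).IsPrime :=
    (Ideal.span_singleton_prime (by norm_num)).2 (Int.prime_iff_natAbs_prime.2 (by norm_num))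
  refine Polynomial.IsEisensteinAt.irreducible (𝓟 := Ideal.span {(7 : ℤ)}) ⟨?_, ?_, ?_⟩ hprime
    hmonic.isPrimitive (by rw [hdeg]; norm_num)
  · rw [hmonic.leadingCoeff, Ideal.mem_span_singleton]; norm_num
  · intro n hn
    rw [hdeg] at hn
    rw [Ideal.mem_span_singleton]
    interval_cases n <;> simp
  · rw [Ideal.span_singleton_pow, Ideal.mem_span_singleton]
    simp

omit hR in
/-- The `Fact` for `E = ℚ(ζ₇) = ℚ[T]/(T⁶ + 7T⁴ + 14T² + 7)`: irreducible over `ℚ` (Gauss). [folklore] -/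
theorem zeta7_fact_cmPolyQ : Fact (Irreducible (cmPolyQ (X ^ 3 + C 7 * X ^ 2 + C 14 * X + C 7 : Polynomial ℤ))) := by
  refine ⟨?_⟩
  have hmonic : (X ^ 6 + C (7 : ℤ) * X ^ 4 + C 14 * X ^ 2 + C 7 : Polynomial ℤ).Monic := by monicity!
  have h := (hmonic.irreducible_iff_irreducible_map_fraction_map (K := ℚ)).1 zeta7_irreducible_cmPoly_int
  have hc : (X ^ 3 + C (7 : ℤ) * X ^ 2 + C 14 * X + C 7 : Polynomial ℤ).comp (X ^ 2) =
      (X ^ 6 + C (7 : ℤ) * X ^ 4 + C 14 * X ^ 2 + C 7 : Polynomial ℤ) := by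
    simp only [add_comp, mul_comp, pow_comp, X_comp, C_comp]
    ring
  have e : cmPolyQ (X ^ 3 + C (7 : ℤ) * X ^ 2 + C 14 * X + C 7) =
      (X ^ 6 + C (7 : ℤ) * X ^ 4 + C 14 * X ^ 2 + C 7 : Polynomial ℤ).map (algebraMap ℤ ℚ) := by
    rw [algebraMap_int_eq, ← hc]
  rw [e]
  exact h

omit hR in
/-- The `Fact` for `F = ℚ(ζ₇)⁺ = realField R₇` (from the one for `E`): the instance under which
`cmNormResidueGroup R`, the index type of the `g = 12` table, is a group. [folklore] -/
theorem zeta7_fact_realPolyQ : Fact (Irreducible (realPolyQ (X ^ 3 + C 7 * X ^ 2 + C 14 * X + C 7 : Polynomial ℤ))) := by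
  haveI := zeta7_fact_cmPolyQ
  exact fact_irreducible_realPolyQ_of_cmPolyQ _

/-- **`ζ₇ = (−5 + η − 5η² − η⁴)/2` is a primitive 7th root of unity in `E = ℚ[T]/(T⁶ + 7T⁴ + 14T² + 7)`**
(`Φ₇(ζ₇) = 0`, checked against `η⁶ + 7η⁴ + 14η² + 7 = 0`). [cite: Washington1997, Ch. 2] -/
theorem zeta7_isPrimitiveRoot [Fact (Irreducible (cmPolyQ R))] :
    IsPrimitiveRoot ((-5 + cmRoot R - 5 * cmRoot R ^ 2 - cmRoot R ^ 4) / 2 : cmField R) 7 := by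
  have ht := cmRoot_sextic R hR
  push_cast at ht
  haveI : Fact (Nat.Prime 7) := ⟨by norm_num⟩
  refine Polynomial.isRoot_cyclotomic_iff.1 ?_
  rw [Polynomial.cyclotomic_prime, Polynomial.IsRoot.def]
  simp only [Finset.sum_range_succ, Finset.sum_range_zero, eval_add, eval_pow, eval_X, eval_one, zero_add, pow_zero]
  linear_combination (1597 / 64 - 501 / 16 * cmRoot R + 7879 / 64 * cmRoot R ^ 2 - 3409 / 32 * cmRoot R ^ 3
    + 15461 / 64 * cmRoot R ^ 4 - 4805 / 32 * cmRoot R ^ 5 + 16539 / 64 * cmRoot R ^ 6 - 453 / 4 * cmRoot R ^ 7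
    + 10857 / 64 * cmRoot R ^ 8 - 1583 / 32 * cmRoot R ^ 9 + 4621 / 64 * cmRoot R ^ 10 - 25 / 2 * cmRoot R ^ 11
    + 645 / 32 * cmRoot R ^ 12 - 27 / 16 * cmRoot R ^ 13 + 57 / 16 * cmRoot R ^ 14 - 3 / 32 * cmRoot R ^ 15
    + 23 / 64 * cmRoot R ^ 16 + 1 / 64 * cmRoot R ^ 18) * ht

/-- `ζ₇ · ζ̄₇ = 1` with `ζ̄₇ = ζ₇(−η) = (−5 − η − 5η² − η⁴)/2` (`|ζ₇| = 1`; `η̄ = −η`). [cite: Washington1997, Ch. 2] -/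
theorem zeta7_mul_conj [Fact (Irreducible (cmPolyQ R))] :
    ((-5 + cmRoot R - 5 * cmRoot R ^ 2 - cmRoot R ^ 4) / 2 : cmField R) *
      ((-5 - cmRoot R - 5 * cmRoot R ^ 2 - cmRoot R ^ 4) / 2) = 1 := by
  have ht := cmRoot_sextic R hR
  push_cast at ht
  linear_combination (3 / 4 + 1 / 4 * cmRoot R ^ 2) * ht

/-- **`η = ζ₇ − ζ₇⁶ = ζ₇ − ζ₇⁻¹`**: Deligne's generator of the carrier is `ζ − ζ⁻¹`. [cite: Deligne1982HodgeCycles, §4 p. 30] -/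
theorem zeta7_cmRoot_eq [Fact (Irreducible (cmPolyQ R))] :
    cmRoot R = ((-5 + cmRoot R - 5 * cmRoot R ^ 2 - cmRoot R ^ 4) / 2 : cmField R) -
      ((-5 + cmRoot R - 5 * cmRoot R ^ 2 - cmRoot R ^ 4) / 2) ^ (7 - 1) := by
  have h7 := (zeta7_isPrimitiveRoot hR).pow_eq_one
  have hc := zeta7_mul_conj hR
  set u : cmField R := (-5 + cmRoot R - 5 * cmRoot R ^ 2 - cmRoot R ^ 4) / 2 with hu
  set u' : cmField R := (-5 - cmRoot R - 5 * cmRoot R ^ 2 - cmRoot R ^ 4) / 2 with hu'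
  have h6 : u ^ (7 - 1) = u' := by
    calc u ^ (7 - 1) = u ^ 6 * (u * u') := by rw [hc, mul_one]
      _ = u ^ 7 * u' := by ring
      _ = u' := by rw [h7, one_mul]
  rw [h6, hu, hu']
  ring

/-- **The roots of `S³ + 7S² + 14S + 7` are real and negative** (they are `(ζ₇ᵏ − ζ₇⁻ᵏ)² = −4 sin²(2πk/7)`; by the
root-of-unity route `roots_real_neg_of_pow_eq_one`, no root location needed). [cite: Washington1997, Ch. 2] -/
theorem zeta7_roots_real_neg [Fact (Irreducible (cmPolyQ R))] :
    ∀ s : ℂ, Polynomial.eval₂ (Int.castRingHom ℂ) s R = 0 → s.im = 0 ∧ s.re < 0 :=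
  roots_real_neg_of_pow_eq_one R (by norm_num) (zeta7_isPrimitiveRoot hR).pow_eq_one (zeta7_cmRoot_eq hR)
    (by rw [coeff_zero_of_cubic R hR]; norm_num)

/-- **`E = ℚ[T]/(T⁶ + 7T⁴ + 14T² + 7)` is the 7th cyclotomic field: `IsCyclotomicExtension {7} ℚ E`** (`ζ₇ ∈ E`
primitive and `η = ζ₇ − ζ₇⁶` is generated by the 7th roots of unity). [cite: Washington1997, Ch. 2] -/
theorem zeta7_isCyclotomicExtension [Fact (Irreducible (cmPolyQ R))] : IsCyclotomicExtension {7} ℚ (cmField R) := by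
  have hζ := zeta7_isPrimitiveRoot hR
  refine (IsCyclotomicExtension.iff_singleton 7 ℚ (cmField R)).2 ⟨⟨_, hζ⟩, mem_adjoin_of_cmRoot_mem R ?_⟩
  have hmem : ((-5 + cmRoot R - 5 * cmRoot R ^ 2 - cmRoot R ^ 4) / 2 : cmField R) ∈
      Algebra.adjoin ℚ {b : cmField R | b ^ 7 = 1} := Algebra.subset_adjoin hζ.pow_eq_one
  rw [zeta7_cmRoot_eq hR]
  exact Subalgebra.sub_mem _ hmem (Subalgebra.pow_mem _ hmem _)

omit hR in
/-- **`ℚ(ζ₇)/ℚ` is Galois** (a cyclotomic extension; stated for the carrier `R` literally). [cite: Washington1997, Ch. 2] -/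
theorem zeta7_isGalois :
    haveI := zeta7_fact_cmPolyQ
    IsGalois ℚ (cmField (X ^ 3 + C 7 * X ^ 2 + C 14 * X + C 7 : Polynomial ℤ)) := by
  haveI := zeta7_fact_cmPolyQ
  haveI := zeta7_isCyclotomicExtension (R := (X ^ 3 + C 7 * X ^ 2 + C 14 * X + C 7)) rfl
  exact IsCyclotomicExtension.isGalois {7} ℚ (cmField (X ^ 3 + C 7 * X ^ 2 + C 14 * X + C 7 : Polynomial ℤ))

omit hR in
/-- **`Gal(ℚ(ζ₇)/ℚ)` is cyclic** (`σ ↦ (ζ₇ ↦ ζ₇^a)` embeds it in `(ℤ/7)^×`, cyclic). [cite: Washington1997, Ch. 2] -/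
theorem zeta7_isCyclic : IsCyclic (cmField (X ^ 3 + C 7 * X ^ 2 + C 14 * X + C 7 : Polynomial ℤ) ≃ₐ[ℚ] cmField (X ^ 3 + C 7 * X ^ 2 + C 14 * X + C 7 : Polynomial ℤ)) := by
  haveI := zeta7_fact_cmPolyQ
  haveI := zeta7_isCyclotomicExtension (R := (X ^ 3 + C 7 * X ^ 2 + C 14 * X + C 7)) rfl
  haveI : IsCyclic (ZMod 7)ˣ := ZMod.isCyclic_units_prime (by norm_num)
  exact isCyclic_of_injective _ ((zeta7_isPrimitiveRoot (R := (X ^ 3 + C 7 * X ^ 2 + C 14 * X + C 7)) rfl).autToPow_injective ℚ)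

/-- **The rows `W12.ℚ(ζ₇).δ` (`g = 12`, `(e₀, k) = (3, 2)`): on EVERY row a CM twelvefold with HC in the kernel.** For
every `δ ∈ cmNormResidueGroup (S³ + 7S² + 14S + 7)` (`= ℚ(ζ₇)⁺^× / Nm ℚ(ζ₇)^×`): `A ≅ B⁴`, `B` a SIMPLE CM abelian
threefold (CM by `ℚ(ζ₇)`), a Weil-type `(2,2;2,2;2,2)` datum relative to `ℚ(ζ₇)`, a Rosati-compatible polarization
class of discriminant `δ`, `HodgeConjectureFor A.dim A.X` (kernel, unconditional) and `W_E(A) ⊗ ℂ ⊂ H⁴(A)` algebraic.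
[cite: Pohlmann1968, Thm. 1] [cite: Schmidt1984CMArithmetik, Kap. III Satz 2.1] [cite: Deligne1982HodgeCycles, §5 (c) pp. 38–39] -/
theorem zeta7_carrier_rows_hodgeConjectureFor [Fact (Irreducible (realPolyQ R))] (δ : cmNormResidueGroup R) :
    ∃ (A : AbelianVariety ℂ) (η : A ⟶ A) (h : complexBetti A.X 2) (B : AbelianVariety ℂ),
      Nonempty (A ≅ ⨁ fun _ : Fin 4 => B) ∧ B.IsSimple ∧ B.dim = 3 ∧ IsOfCMType B ∧ A.dim = 12 ∧ IsOfCMType A ∧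
      IsWeilTypeCM A η R 3 2 ∧ IsPolarizationClass A.dim A.X h ∧ RosatiCompatible A η h ∧
      HasWeilDiscriminantCM A η R 3 2 h δ ∧ HodgeConjectureFor A.dim A.X ∧
      weilClassesField A η (R.comp (X ^ 2)) (2 * 2) ≤ algebraicClasses A.X 2 := by
  subst hR
  haveI := zeta7_fact_cmPolyQ
  have hroots := zeta7_roots_real_neg (R := (X ^ 3 + C 7 * X ^ 2 + C 14 * X + C 7)) rfl
  haveI : IsCMField (cmField (X ^ 3 + C 7 * X ^ 2 + C 14 * X + C 7 : Polynomial ℤ)) := isCMField_cmField hroots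
  haveI := zeta7_isGalois
  obtain ⟨hRm, hRdeg⟩ := monic_and_natDegree_of_cubic (X ^ 3 + C 7 * X ^ 2 + C 14 * X + C 7 : Polynomial ℤ) rfl
  obtain ⟨B, η, h, hs, hd, hB, hcm, hW, hpol, hros, hdisc, hHC, halg⟩ :=
    carrier_exists_simplePower_hodgeConjectureFor_of_isCyclic _ hRm hRdeg (by norm_num) hroots zeta7_isCyclic two_pos δ
  exact ⟨_, η, h, B, ⟨Iso.refl _⟩, hs, hd, hB, by rw [hW.dim_eq]; norm_num, hcm, hW, hpol, hros, hdisc, hHC, halg⟩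

/-- **All ranks over `ℚ(ζ₇)`: rows `W_{12p/2·2}.ℚ(ζ₇).δ` of `E`-rank `2p`, every `p ≥ 1` (`g = 6p`… `= 2·3·p`), every
`δ`:** the power `B^{2p}` of a SIMPLE CM abelian threefold with a Weil-type datum of `E`-rank `2p`, a Rosati-compatible
polarization class of discriminant `δ`, HC for `B^{2p}` in the kernel and `W_E ⊗ ℂ ⊂ H^{2p}` algebraic.
[cite: Pohlmann1968, Thm. 1] [cite: Deligne1982HodgeCycles, §5 (c) pp. 38–39] -/
theorem zeta7_carrier_allRanks_hodgeConjectureFor [Fact (Irreducible (realPolyQ R))] {p : ℕ} (hp : 0 < p)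
    (δ : cmNormResidueGroup R) :
    ∃ (B : AbelianVariety ℂ) (η : (⨁ fun _ : Fin (2 * p) => B) ⟶ ⨁ fun _ : Fin (2 * p) => B)
      (h : complexBetti (⨁ fun _ : Fin (2 * p) => B).X 2),
      B.IsSimple ∧ B.dim = 3 ∧ IsOfCMType B ∧
      IsOfCMType (⨁ fun _ : Fin (2 * p) => B) ∧ IsWeilTypeCM (⨁ fun _ : Fin (2 * p) => B) η R 3 p ∧
      IsPolarizationClass (⨁ fun _ : Fin (2 * p) => B).dim (⨁ fun _ : Fin (2 * p) => B).X h ∧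
      RosatiCompatible (⨁ fun _ : Fin (2 * p) => B) η h ∧
      HasWeilDiscriminantCM (⨁ fun _ : Fin (2 * p) => B) η R 3 p h δ ∧
      HodgeConjectureFor (⨁ fun _ : Fin (2 * p) => B).dim (⨁ fun _ : Fin (2 * p) => B).X ∧
      weilClassesField (⨁ fun _ : Fin (2 * p) => B) η (R.comp (X ^ 2)) (2 * p) ≤
        algebraicClasses (⨁ fun _ : Fin (2 * p) => B).X p := by
  subst hR
  haveI := zeta7_fact_cmPolyQ
  have hroots := zeta7_roots_real_neg (R := (X ^ 3 + C 7 * X ^ 2 + C 14 * X + C 7)) rfl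
  haveI : IsCMField (cmField (X ^ 3 + C 7 * X ^ 2 + C 14 * X + C 7 : Polynomial ℤ)) := isCMField_cmField hroots
  haveI := zeta7_isGalois
  obtain ⟨hRm, hRdeg⟩ := monic_and_natDegree_of_cubic (X ^ 3 + C 7 * X ^ 2 + C 14 * X + C 7 : Polynomial ℤ) rfl
  exact carrier_exists_simplePower_hodgeConjectureFor_of_isCyclic _ hRm hRdeg (by norm_num) hroots zeta7_isCyclic hp δ

end Zeta7
/-! ## §2 `ℚ(ζ₉)`: `R = S³ + 6S² + 9S + 3`, `η = ζ₉ − ζ₉⁻¹` -/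

section Zeta9

variable {R : Polynomial ℤ} (hR : R = X ^ 3 + C 6 * X ^ 2 + C 9 * X + C 3)
include hR

omit hR in
/-- `T⁶ + 6T⁴ + 9T² + 3` (the minimal polynomial of `ζ₉ − ζ₉⁻¹`) is Eisenstein at `3`, hence irreducible over `ℤ`.
[folklore] -/
theorem zeta9_irreducible_cmPoly_int :
    Irreducible (X ^ 6 + C (6 : ℤ) * X ^ 4 + C 9 * X ^ 2 + C 3 : Polynomial ℤ) := by
  have hmonic : (X ^ 6 + C (6 : ℤ) * X ^ 4 + C 9 * X ^ 2 + C 3 : Polynomial ℤ).Monic := by monicity!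
  have hdeg : (X ^ 6 + C (6 : ℤ) * X ^ 4 + C 9 * X ^ 2 + C 3 : Polynomial ℤ).natDegree = 6 := by compute_degree!
  have hprime : (Ideal.span {(3 : ℤ)}).IsPrime :=
    (Ideal.span_singleton_prime (by norm_num)).2 (Int.prime_iff_natAbs_prime.2 (by norm_num))
  refine Polynomial.IsEisensteinAt.irreducible (𝓟 := Ideal.span {(3 : ℤ)}) ⟨?_, ?_, ?_⟩ hprime
    hmonic.isPrimitive (by rw [hdeg]; norm_num)
  · rw [hmonic.leadingCoeff, Ideal.mem_span_singleton]; norm_num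
  · intro n hn
    rw [hdeg] at hn
    rw [Ideal.mem_span_singleton]
    interval_cases n <;> simp
  · rw [Ideal.span_singleton_pow, Ideal.mem_span_singleton]
    simp

omit hR in
/-- The `Fact` for `E = ℚ(ζ₉) = ℚ[T]/(T⁶ + 6T⁴ + 9T² + 3)`: irreducible over `ℚ` (Gauss). [folklore] -/
theorem zeta9_fact_cmPolyQ : Fact (Irreducible (cmPolyQ (X ^ 3 + C 6 * X ^ 2 + C 9 * X + C 3 : Polynomial ℤ))) := by
  refine ⟨?_⟩
  have hmonic : (X ^ 6 + C (6 : ℤ) * X ^ 4 + C 9 * X ^ 2 + C 3 : Polynomial ℤ).Monic := by monicity!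
  have h := (hmonic.irreducible_iff_irreducible_map_fraction_map (K := ℚ)).1 zeta9_irreducible_cmPoly_int
  have hc : (X ^ 3 + C (6 : ℤ) * X ^ 2 + C 9 * X + C 3 : Polynomial ℤ).comp (X ^ 2) =
      (X ^ 6 + C (6 : ℤ) * X ^ 4 + C 9 * X ^ 2 + C 3 : Polynomial ℤ) := by
    simp only [add_comp, mul_comp, pow_comp, X_comp, C_comp]
    ring
  have e : cmPolyQ (X ^ 3 + C (6 : ℤ) * X ^ 2 + C 9 * X + C 3) =
      (X ^ 6 + C (6 : ℤ) * X ^ 4 + C 9 * X ^ 2 + C 3 : Polynomial ℤ).map (algebraMap ℤ ℚ) := by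
    rw [algebraMap_int_eq, ← hc]
  rw [e]
  exact h

omit hR in
/-- The `Fact` for `F = ℚ(ζ₉)⁺ = realField R₉` (from the one for `E`): the instance under which
`cmNormResidueGroup R`, the index type of the `g = 12` table, is a group. [folklore] -/
theorem zeta9_fact_realPolyQ : Fact (Irreducible (realPolyQ (X ^ 3 + C 6 * X ^ 2 + C 9 * X + C 3 : Polynomial ℤ))) := by
  haveI := zeta9_fact_cmPolyQ
  exact fact_irreducible_realPolyQ_of_cmPolyQ _

/-- `ζ₉³ = ω` is a primitive CUBE root of unity: `Φ₃(ζ₉³) = ζ₉⁶ + ζ₉³ + 1 = Φ₉(ζ₉) = 0` for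
`ζ₉ = (−4 + η − 5η² − η⁴)/2 ∈ E = ℚ[T]/(T⁶ + 6T⁴ + 9T² + 3)`. [cite: Washington1997, Ch. 2] -/
theorem zeta9_isPrimitiveRoot_cube [Fact (Irreducible (cmPolyQ R))] :
    IsPrimitiveRoot (((-4 + cmRoot R - 5 * cmRoot R ^ 2 - cmRoot R ^ 4) / 2 : cmField R) ^ 3) 3 := by
  have ht := cmRoot_sextic R hR
  push_cast at ht
  haveI : Fact (Nat.Prime 3) := ⟨Nat.prime_three⟩
  refine Polynomial.isRoot_cyclotomic_iff.1 ?_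
  rw [Polynomial.cyclotomic_prime, Polynomial.IsRoot.def]
  simp only [Finset.sum_range_succ, Finset.sum_range_zero, eval_add, eval_pow, eval_X, eval_one, zero_add, pow_zero]
  linear_combination (19 - 30 * cmRoot R + 225 / 2 * cmRoot R ^ 2 - 893 / 8 * cmRoot R ^ 3 + 1941 / 8 * cmRoot R ^ 4
    - 1329 / 8 * cmRoot R ^ 5 + 17563 / 64 * cmRoot R ^ 6 - 4113 / 32 * cmRoot R ^ 7 + 2967 / 16 * cmRoot R ^ 8
    - 56 * cmRoot R ^ 9 + 5109 / 64 * cmRoot R ^ 10 - 441 / 32 * cmRoot R ^ 11 + 355 / 16 * cmRoot R ^ 12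
    - 57 / 32 * cmRoot R ^ 13 + 123 / 32 * cmRoot R ^ 14 - 3 / 32 * cmRoot R ^ 15 + 3 / 8 * cmRoot R ^ 16
    + 1 / 64 * cmRoot R ^ 18) * ht

/-- **`ζ₉ = (−4 + η − 5η² − η⁴)/2` is a primitive 9th root of unity in `E = ℚ[T]/(T⁶ + 6T⁴ + 9T² + 3)`** (order
`3² `: `ζ₉³ ≠ 1`, `ζ₉⁹ = 1`). [cite: Washington1997, Ch. 2] -/
theorem zeta9_isPrimitiveRoot [Fact (Irreducible (cmPolyQ R))] :
    IsPrimitiveRoot ((-4 + cmRoot R - 5 * cmRoot R ^ 2 - cmRoot R ^ 4) / 2 : cmField R) 9 := by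
  have h3 := zeta9_isPrimitiveRoot_cube hR
  haveI : Fact (Nat.Prime 3) := ⟨Nat.prime_three⟩
  have hord : orderOf ((-4 + cmRoot R - 5 * cmRoot R ^ 2 - cmRoot R ^ 4) / 2 : cmField R) = 3 ^ (1 + 1) :=
    orderOf_eq_prime_pow (by rw [pow_one]; exact h3.ne_one (by norm_num))
      (by rw [show (3 : ℕ) ^ (1 + 1) = 3 * 3 by norm_num, pow_mul]; exact h3.pow_eq_one)
  have h := IsPrimitiveRoot.orderOf ((-4 + cmRoot R - 5 * cmRoot R ^ 2 - cmRoot R ^ 4) / 2 : cmField R)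
  rw [hord] at h
  norm_num at h
  exact h

/-- `ζ₉ · ζ̄₉ = 1` with `ζ̄₉ = ζ₉(−η) = (−4 − η − 5η² − η⁴)/2`. [cite: Washington1997, Ch. 2] -/
theorem zeta9_mul_conj [Fact (Irreducible (cmPolyQ R))] :
    ((-4 + cmRoot R - 5 * cmRoot R ^ 2 - cmRoot R ^ 4) / 2 : cmField R) *
      ((-4 - cmRoot R - 5 * cmRoot R ^ 2 - cmRoot R ^ 4) / 2) = 1 := by
  have ht := cmRoot_sextic R hR
  push_cast at ht
  linear_combination (1 + 1 / 4 * cmRoot R ^ 2) * ht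

/-- **`η = ζ₉ − ζ₉⁸ = ζ₉ − ζ₉⁻¹`.** [cite: Deligne1982HodgeCycles, §4 p. 30] -/
theorem zeta9_cmRoot_eq [Fact (Irreducible (cmPolyQ R))] :
    cmRoot R = ((-4 + cmRoot R - 5 * cmRoot R ^ 2 - cmRoot R ^ 4) / 2 : cmField R) -
      ((-4 + cmRoot R - 5 * cmRoot R ^ 2 - cmRoot R ^ 4) / 2) ^ (9 - 1) := by
  have h9 := (zeta9_isPrimitiveRoot hR).pow_eq_one
  have hc := zeta9_mul_conj hR
  set u : cmField R := (-4 + cmRoot R - 5 * cmRoot R ^ 2 - cmRoot R ^ 4) / 2 with hu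
  set u' : cmField R := (-4 - cmRoot R - 5 * cmRoot R ^ 2 - cmRoot R ^ 4) / 2 with hu'
  have h8 : u ^ (9 - 1) = u' := by
    calc u ^ (9 - 1) = u ^ 8 * (u * u') := by rw [hc, mul_one]
      _ = u ^ 9 * u' := by ring
      _ = u' := by rw [h9, one_mul]
  rw [h8, hu, hu']
  ring

/-- **The roots of `S³ + 6S² + 9S + 3` are real and negative** (`(ζ₉ᵏ − ζ₉⁻ᵏ)² = −4 sin²(2πk/9)`; root-of-unity route).
[cite: Washington1997, Ch. 2] -/
theorem zeta9_roots_real_neg [Fact (Irreducible (cmPolyQ R))] :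
    ∀ s : ℂ, Polynomial.eval₂ (Int.castRingHom ℂ) s R = 0 → s.im = 0 ∧ s.re < 0 :=
  roots_real_neg_of_pow_eq_one R (by norm_num) (zeta9_isPrimitiveRoot hR).pow_eq_one (zeta9_cmRoot_eq hR)
    (by rw [coeff_zero_of_cubic R hR]; norm_num)

/-- **`E = ℚ[T]/(T⁶ + 6T⁴ + 9T² + 3)` is the 9th cyclotomic field: `IsCyclotomicExtension {9} ℚ E`.**
[cite: Washington1997, Ch. 2] -/
theorem zeta9_isCyclotomicExtension [Fact (Irreducible (cmPolyQ R))] : IsCyclotomicExtension {9} ℚ (cmField R) := by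
  have hζ := zeta9_isPrimitiveRoot hR
  refine (IsCyclotomicExtension.iff_singleton 9 ℚ (cmField R)).2 ⟨⟨_, hζ⟩, mem_adjoin_of_cmRoot_mem R ?_⟩
  have hmem : ((-4 + cmRoot R - 5 * cmRoot R ^ 2 - cmRoot R ^ 4) / 2 : cmField R) ∈
      Algebra.adjoin ℚ {b : cmField R | b ^ 9 = 1} := Algebra.subset_adjoin hζ.pow_eq_one
  rw [zeta9_cmRoot_eq hR]
  exact Subalgebra.sub_mem _ hmem (Subalgebra.pow_mem _ hmem _)

omit hR in
/-- **`ℚ(ζ₉)/ℚ` is Galois** (a cyclotomic extension; stated for the carrier `R` literally). [cite: Washington1997, Ch. 2] -/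
theorem zeta9_isGalois :
    haveI := zeta9_fact_cmPolyQ
    IsGalois ℚ (cmField (X ^ 3 + C 6 * X ^ 2 + C 9 * X + C 3 : Polynomial ℤ)) := by
  haveI := zeta9_fact_cmPolyQ
  haveI := zeta9_isCyclotomicExtension (R := (X ^ 3 + C 6 * X ^ 2 + C 9 * X + C 3)) rfl
  exact IsCyclotomicExtension.isGalois {9} ℚ (cmField (X ^ 3 + C 6 * X ^ 2 + C 9 * X + C 3 : Polynomial ℤ))

omit hR in
/-- **`Gal(ℚ(ζ₉)/ℚ)` is cyclic** (`↪ (ℤ/9)^×`, cyclic as `9 = 3²` is an odd prime power). [cite: Washington1997, Ch. 2] -/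
theorem zeta9_isCyclic : IsCyclic (cmField (X ^ 3 + C 6 * X ^ 2 + C 9 * X + C 3 : Polynomial ℤ) ≃ₐ[ℚ] cmField (X ^ 3 + C 6 * X ^ 2 + C 9 * X + C 3 : Polynomial ℤ)) := by
  haveI := zeta9_fact_cmPolyQ
  haveI := zeta9_isCyclotomicExtension (R := (X ^ 3 + C 6 * X ^ 2 + C 9 * X + C 3)) rfl
  haveI : IsCyclic (ZMod 9)ˣ :=
    (ZMod.isCyclic_units_iff_of_odd (by decide)).2 ⟨3, 2, Nat.prime_three, by decide, by norm_num⟩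
  exact isCyclic_of_injective _ ((zeta9_isPrimitiveRoot (R := (X ^ 3 + C 6 * X ^ 2 + C 9 * X + C 3)) rfl).autToPow_injective ℚ)

/-- **The rows `W12.ℚ(ζ₉).δ` (`g = 12`, `(e₀, k) = (3, 2)`): on EVERY row a CM twelvefold with HC in the kernel**
(`A ≅ B⁴`, `B` a SIMPLE CM abelian threefold with CM by `ℚ(ζ₉)`; index type `cmNormResidueGroup (S³ + 6S² + 9S + 3)`
`= ℚ(ζ₉)⁺^× / Nm ℚ(ζ₉)^×`). [cite: Pohlmann1968, Thm. 1] [cite: Schmidt1984CMArithmetik, Kap. III Satz 2.1]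
[cite: Deligne1982HodgeCycles, §5 (c) pp. 38–39] -/
theorem zeta9_carrier_rows_hodgeConjectureFor [Fact (Irreducible (realPolyQ R))] (δ : cmNormResidueGroup R) :
    ∃ (A : AbelianVariety ℂ) (η : A ⟶ A) (h : complexBetti A.X 2) (B : AbelianVariety ℂ),
      Nonempty (A ≅ ⨁ fun _ : Fin 4 => B) ∧ B.IsSimple ∧ B.dim = 3 ∧ IsOfCMType B ∧ A.dim = 12 ∧ IsOfCMType A ∧
      IsWeilTypeCM A η R 3 2 ∧ IsPolarizationClass A.dim A.X h ∧ RosatiCompatible A η h ∧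
      HasWeilDiscriminantCM A η R 3 2 h δ ∧ HodgeConjectureFor A.dim A.X ∧
      weilClassesField A η (R.comp (X ^ 2)) (2 * 2) ≤ algebraicClasses A.X 2 := by
  subst hR
  haveI := zeta9_fact_cmPolyQ
  have hroots := zeta9_roots_real_neg (R := (X ^ 3 + C 6 * X ^ 2 + C 9 * X + C 3)) rfl
  haveI : IsCMField (cmField (X ^ 3 + C 6 * X ^ 2 + C 9 * X + C 3 : Polynomial ℤ)) := isCMField_cmField hroots
  haveI := zeta9_isGalois
  obtain ⟨hRm, hRdeg⟩ := monic_and_natDegree_of_cubic (X ^ 3 + C 6 * X ^ 2 + C 9 * X + C 3 : Polynomial ℤ) rfl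
  obtain ⟨B, η, h, hs, hd, hB, hcm, hW, hpol, hros, hdisc, hHC, halg⟩ :=
    carrier_exists_simplePower_hodgeConjectureFor_of_isCyclic _ hRm hRdeg (by norm_num) hroots zeta9_isCyclic two_pos δ
  exact ⟨_, η, h, B, ⟨Iso.refl _⟩, hs, hd, hB, by rw [hW.dim_eq]; norm_num, hcm, hW, hpol, hros, hdisc, hHC, halg⟩

/-- **All ranks over `ℚ(ζ₉)`: every `E`-rank `2p` (`g = 6p`), every `δ`:** `B^{2p}`, `B` a SIMPLE CM threefold, a
Weil-type datum of `E`-rank `2p`, a Rosati-compatible polarization class of discriminant `δ`, HC in the kernel,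
`W_E ⊗ ℂ ⊂ H^{2p}` algebraic. [cite: Pohlmann1968, Thm. 1] [cite: Deligne1982HodgeCycles, §5 (c) pp. 38–39] -/
theorem zeta9_carrier_allRanks_hodgeConjectureFor [Fact (Irreducible (realPolyQ R))] {p : ℕ} (hp : 0 < p)
    (δ : cmNormResidueGroup R) :
    ∃ (B : AbelianVariety ℂ) (η : (⨁ fun _ : Fin (2 * p) => B) ⟶ ⨁ fun _ : Fin (2 * p) => B)
      (h : complexBetti (⨁ fun _ : Fin (2 * p) => B).X 2),
      B.IsSimple ∧ B.dim = 3 ∧ IsOfCMType B ∧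
      IsOfCMType (⨁ fun _ : Fin (2 * p) => B) ∧ IsWeilTypeCM (⨁ fun _ : Fin (2 * p) => B) η R 3 p ∧
      IsPolarizationClass (⨁ fun _ : Fin (2 * p) => B).dim (⨁ fun _ : Fin (2 * p) => B).X h ∧
      RosatiCompatible (⨁ fun _ : Fin (2 * p) => B) η h ∧
      HasWeilDiscriminantCM (⨁ fun _ : Fin (2 * p) => B) η R 3 p h δ ∧
      HodgeConjectureFor (⨁ fun _ : Fin (2 * p) => B).dim (⨁ fun _ : Fin (2 * p) => B).X ∧
      weilClassesField (⨁ fun _ : Fin (2 * p) => B) η (R.comp (X ^ 2)) (2 * p) ≤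
        algebraicClasses (⨁ fun _ : Fin (2 * p) => B).X p := by
  subst hR
  haveI := zeta9_fact_cmPolyQ
  have hroots := zeta9_roots_real_neg (R := (X ^ 3 + C 6 * X ^ 2 + C 9 * X + C 3)) rfl
  haveI : IsCMField (cmField (X ^ 3 + C 6 * X ^ 2 + C 9 * X + C 3 : Polynomial ℤ)) := isCMField_cmField hroots
  haveI := zeta9_isGalois
  obtain ⟨hRm, hRdeg⟩ := monic_and_natDegree_of_cubic (X ^ 3 + C 6 * X ^ 2 + C 9 * X + C 3 : Polynomial ℤ) rfl
  exact carrier_exists_simplePower_hodgeConjectureFor_of_isCyclic _ hRm hRdeg (by norm_num) hroots zeta9_isCyclic hp δ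

end Zeta9
end Summit.HodgeConjecture.HodgeConjecture.Ring2.WeilCoverageCM
end
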